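import Literature.Computability.AlgebraicComplexity.RectangularExponentScalarExtension
import Literature.Computability.AlgebraicComplexity.RectangularExponentBounds
import Literature.Computability.AlgebraicComplexity.RectangularExponentSymmetry
import HarnessLib

/-!
# ω-census tool law: the rectangular exponent `ω(a, b, c)` is invariant under scalar extension for ALL REAL `a, b, c`

Cell `pub-omega` (unit `pub-omega-laser-g17`), topic `Summits/MatrixMultiplication/OmegaCensus`.
Framing (verbatim): lottery ticket; floor = certified bounds/negative ranges. HONEST FRAMING: a TOOL LAW about
the tree's rank-form rectangular exponent `omegaRect K a b c = ω_K(a,b,c) = inf {β | R(⟨⌈n^a⌉,⌈n^b⌉,⌈n^c⌉⟩) = O(n^β)}`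
(Le Gall 2012 §2; `Literature/…/RectangularExponent.lean`); nothing on the value of `ω`, no census value.

Bürgisser–Clausen–Shokrollahi 1997, Cor. (15.18) (Schönhage): `ω(k) = ω(K)` for every field extension. The tree
proves it along any homomorphism of fields (`BCS1997_cor_15_18`, `OmegaScalarExtensionInvariance.lean`) together
with its rectangular reading for NATURAL exponents, `omegaRect_eq_omegaRect_of_ringHom (f : K →+* L) (a b c : ℕ)`,
which carries `-- TODO(general form): real exponents a, b, c`; `RectangularExponentScalarExtension.lean` closed the
TODO for the one-parameter family `ω(1, p, 1)`, `p ≥ 0`. This file closes it in general: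

* `omegaRect_eq_of_ringHom : ∀ (f : K →+* L) (a b c : ℝ), omegaRect K a b c = omegaRect L a b c` — NO sign
  hypothesis (negative exponents are harmless: `⌈n^a⌉ = 1 = ⌈n^0⌉` for `a ≤ 0`, `n ≥ 1`, so
  `ω(a,b,c) = ω(a⁺,b⁺,c⁺)`, `omegaRect_max_zero`).
  Route: the natural case and the tree's homogeneity `omegaRect_smul` give all non-negative rationals with a common
  denominator (`omegaRect_natCast_div_eq_of_ringHom`); the general-slot monotonicity (`omegaRect_mono₁/₂/₃`,
  `omegaRect_mono`) and Lipschitz bounds (`omegaRect_le_add₁/₂/₃`, `omegaRect_le_add`: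
  `ω(a,b,p) ≤ ω(a,b,q) + (p − q)` for `q ≤ p`, from `R(⟨⌈n^a⌉,⌈n^b⌉,⌈n^p⌉⟩) ≤ R(⟨⌈n^a⌉,⌈n^b⌉,⌈n^q⌉⟩)·⌈n^{p−q}⌉`;
  the tree had the `(1,1,·)` / `(1,·,1)` slots only) squeeze every non-negative real triple between rational ones.
* by-products: `abs_omegaRect_sub_omegaRect_le` (`|ω(a,b,c) − ω(a',b',c')| ≤ |a−a'| + |b−b'| + |c−c'|`, the
  three-slot form of the Lotti–Romani continuity used in CLLZ 2025, Rem. 3.13) and `continuous_omegaRect`.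
* consequences: `omegaRect_algebraMap`, `omegaRect_eq_rat`, `omegaRect_eq_complex`, `omegaRect_eq_zmod`,
  `omegaRect_eq_of_charP` — **`ω(a,b,c)` depends only on the characteristic** — and the generic transfer of
  `ℂ`-stated bounds to every field of characteristic `0` (`omegaRect_le_of_complex`, `le_omegaRect_of_complex`);
  `omegaRect_one_mid_one_eq_of_ringHom'` drops the hypothesis `0 ≤ p` of the tree's `(1,p,1)` statement.

No printed locator states the real-exponent invariance (BCS (15.18) is the square statement; Lotti–Romani 1983,
Huang–Pan 1998 §2, Le Gall 2012 §2 and CLLZ 2025 Rem. 3.13 supply homogeneity / continuity only), hence the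
placement under the cell topic as a tool law; the printed ingredients are cited in the docstrings.
Everything is proved; no definitions, no named facts.
-/

noncomputable section

open scoped BigOperators

open Filter Asymptotics

namespace Summit.MatrixMultiplication.OmegaCensus

open Literature.Computability.AlgebraicComplexity

/-! ## Negative exponents do not matter: `ω(a,b,c) = ω(a⁺,b⁺,c⁺)` -/

section Slots

variable (K : Type) [Field K]

/-- For `n ≥ 1` and `a ≤ 0` the rectangular dimension `⌈n^a⌉` is `1`. -/
theorem rectDim_of_nonpos {n : ℕ} (hn : 1 ≤ n) {a : ℝ} (ha : a ≤ 0) : rectDim n a = 1 := by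
  have hn' : (1 : ℝ) ≤ n := by exact_mod_cast hn
  have h1 : (n : ℝ) ^ a ≤ 1 := Real.rpow_le_one_of_one_le_of_nonpos hn' ha
  have h0 : 0 < (n : ℝ) ^ a := Real.rpow_pos_of_pos (by linarith) _
  refine le_antisymm ?_ (one_le_rectDim hn a)
  show ⌈(n : ℝ) ^ a⌉₊ ≤ 1
  exact Nat.ceil_le.2 (by exact_mod_cast h1)

/-- For `n ≥ 1`, `⌈n^{max(a,0)}⌉ = ⌈n^a⌉`. -/
theorem rectDim_max_zero {n : ℕ} (hn : 1 ≤ n) (a : ℝ) : rectDim n (max a 0) = rectDim n a := by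
  rcases le_total a 0 with ha | ha
  · rw [max_eq_right ha, rectDim_zero, rectDim_of_nonpos hn ha]
  · rw [max_eq_left ha]

/-- The admissible exponents of `(a,b,c)` are those of `(a⁺,b⁺,c⁺)` (the two rank functions agree from
`n = 1` on). -/
theorem rectAdmissibleExponents_max_zero (a b c : ℝ) :
    rectAdmissibleExponents K (max a 0) (max b 0) (max c 0) = rectAdmissibleExponents K a b c := by
  have hfg : (fun n : ℕ => (tensorRank (matMulTensor K (rectDim n (max a 0)) (rectDim n (max b 0))
      (rectDim n (max c 0))) : ℝ)) =ᶠ[atTop]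
      fun n : ℕ => (tensorRank (matMulTensor K (rectDim n a) (rectDim n b) (rectDim n c)) : ℝ) := by
    filter_upwards [eventually_ge_atTop 1] with n hn
    rw [rectDim_max_zero hn, rectDim_max_zero hn, rectDim_max_zero hn]
  ext β
  exact ⟨fun h => hfg.symm.trans_isBigO h, fun h => hfg.trans_isBigO h⟩

/-- **`ω(a⁺, b⁺, c⁺) = ω(a, b, c)`**: negative exponents may be replaced by `0`. -/
theorem omegaRect_max_zero (a b c : ℝ) :
    omegaRect K (max a 0) (max b 0) (max c 0) = omegaRect K a b c := by
  unfold omegaRect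
  rw [rectAdmissibleExponents_max_zero]

/-! ## Monotonicity of `ω(a,b,c)` in each slot -/

/-- Padding the third dimension (`R(⟨k,m,n⟩) ≤ R(⟨k,m,n'⟩)` for `n ≤ n'`, Bläser 2013 Lemma 5.4) makes the
admissible sets antitone in the third exponent. -/
theorem rectAdmissibleExponents_anti₃ {a b c c' : ℝ} (h : c ≤ c') :
    rectAdmissibleExponents K a b c' ⊆ rectAdmissibleExponents K a b c := by
  intro β hβ
  refine IsBigO.trans ?_ hβ
  refine IsBigO.of_bound 1 ?_
  filter_upwards [eventually_ge_atTop 1] with n hn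
  rw [one_mul, Real.norm_of_nonneg (Nat.cast_nonneg _), Real.norm_of_nonneg (Nat.cast_nonneg _)]
  exact_mod_cast tensorRank_matMulTensor_mono₃ K le_rfl le_rfl (rectDim_mono hn h)

/-- **`ω(a,b,c)` is monotone in the third slot.** -/
theorem omegaRect_mono₃ {a b c c' : ℝ} (h : c ≤ c') : omegaRect K a b c ≤ omegaRect K a b c' :=
  csInf_le_csInf (rectAdmissibleExponents_bddBelow K a b c) (rectAdmissibleExponents_nonempty K a b c')
    (rectAdmissibleExponents_anti₃ K h)

/-- **`ω(a,b,c)` is monotone in the second slot** (third slot and `ω(a,b,c) = ω(a,c,b)`). -/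
theorem omegaRect_mono₂ {a b b' c : ℝ} (h : b ≤ b') : omegaRect K a b c ≤ omegaRect K a b' c := by
  rw [omegaRect_swap₂₃ K a b c, omegaRect_swap₂₃ K a b' c]
  exact omegaRect_mono₃ K h

/-- **`ω(a,b,c)` is monotone in the first slot** (third slot and `ω(a,b,c) = ω(c,b,a)`). -/
theorem omegaRect_mono₁ {a a' b c : ℝ} (h : a ≤ a') : omegaRect K a b c ≤ omegaRect K a' b c := by
  rw [omegaRect_swap₁₃ K a b c, omegaRect_swap₁₃ K a' b c]
  exact omegaRect_mono₃ K h

/-- **`ω` is monotone in all three slots**: `a ≤ a'`, `b ≤ b'`, `c ≤ c'` ⇒ `ω(a,b,c) ≤ ω(a',b',c')`. -/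
theorem omegaRect_mono {a a' b b' c c' : ℝ} (ha : a ≤ a') (hb : b ≤ b') (hc : c ≤ c') :
    omegaRect K a b c ≤ omegaRect K a' b' c' :=
  (omegaRect_mono₁ K ha).trans ((omegaRect_mono₂ K hb).trans (omegaRect_mono₃ K hc))

/-! ## The Lipschitz estimate in each slot -/

/-- **Admissible exponents shift with the third exponent**: if `β` is admissible for `(a, b, q)` and
`q ≤ p` then `β + (p − q)` is admissible for `(a, b, p)`, because
`R(⟨⌈n^a⌉,⌈n^b⌉,⌈n^p⌉⟩) ≤ R(⟨⌈n^a⌉,⌈n^b⌉,⌈n^q⌉⌈n^{p-q}⌉⟩) ≤ R(⟨⌈n^a⌉,⌈n^b⌉,⌈n^q⌉⟩)·⌈n^{p-q}⌉ ≤ 2 C n^{β+(p-q)}`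
(padding; `⟨k,m,de⟩ ≅ ⟨k,m,d⟩ ⊗ ⟨1,1,e⟩`, Bläser 2013 Lemma 5.8; `R(⟨1,1,e⟩) ≤ e`). The `(1,1,·)` slot is the
tree's `add_mem_rectAdmissibleExponents_one_one` (CLLZ 2025, Rem. 3.13; Lotti–Romani 1983). -/
theorem add_mem_rectAdmissibleExponents₃ {a b p q β : ℝ} (hqp : q ≤ p)
    (hβ : β ∈ rectAdmissibleExponents K a b q) :
    β + (p - q) ∈ rectAdmissibleExponents K a b p := by
  obtain ⟨C, hC0, hC⟩ := hβ.exists_nonneg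
  refine IsBigO.of_bound (2 * C) ?_
  filter_upwards [hC.bound, eventually_ge_atTop 1] with n hCn hn
  have hn0 : (0 : ℝ) < n := by exact_mod_cast hn
  rw [Real.norm_of_nonneg (Nat.cast_nonneg _), Real.norm_of_nonneg (Real.rpow_nonneg hn0.le _)]
    at hCn ⊢
  have h1 : tensorRank (matMulTensor K (rectDim n a) (rectDim n b) (rectDim n p)) ≤
      tensorRank (matMulTensor K (rectDim n a) (rectDim n b) (rectDim n q)) * rectDim n (p - q) := by
    calc tensorRank (matMulTensor K (rectDim n a) (rectDim n b) (rectDim n p))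
        ≤ tensorRank (matMulTensor K (rectDim n a * 1) (rectDim n b * 1)
            (rectDim n q * rectDim n (p - q))) := by
          rw [tensorRank_matMulTensor_congr K (Nat.mul_one (rectDim n a)) (Nat.mul_one (rectDim n b))
            rfl]
          exact tensorRank_matMulTensor_mono₃ K le_rfl le_rfl (rectDim_le_rectDim_mul_rectDim hn p q)
      _ ≤ tensorRank (matMulTensor K (rectDim n a) (rectDim n b) (rectDim n q)) *
            tensorRank (matMulTensor K 1 1 (rectDim n (p - q))) :=
          Blaser2013_rank_matMulTensor_mul_le K (rectDim n a) (rectDim n b) (rectDim n q) 1 1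
            (rectDim n (p - q))
      _ ≤ tensorRank (matMulTensor K (rectDim n a) (rectDim n b) (rectDim n q)) * rectDim n (p - q) := by
          refine Nat.mul_le_mul_left _ ?_
          simpa using tensorRank_matMulTensor_le K 1 1 (rectDim n (p - q))
  have hk : (rectDim n (p - q) : ℝ) ≤ 2 * (n : ℝ) ^ (p - q) := by
    simpa [max_eq_left (sub_nonneg.mpr hqp)] using rectDim_le hn (p - q)
  calc (tensorRank (matMulTensor K (rectDim n a) (rectDim n b) (rectDim n p)) : ℝ)
      ≤ (tensorRank (matMulTensor K (rectDim n a) (rectDim n b) (rectDim n q)) * rectDim n (p - q) : ℕ) := by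
        exact_mod_cast h1
    _ = (tensorRank (matMulTensor K (rectDim n a) (rectDim n b) (rectDim n q)) : ℝ) *
          rectDim n (p - q) := by
        push_cast; ring
    _ ≤ (C * (n : ℝ) ^ β) * (2 * (n : ℝ) ^ (p - q)) :=
        mul_le_mul hCn hk (Nat.cast_nonneg _) (by positivity)
    _ = 2 * C * (n : ℝ) ^ (β + (p - q)) := by
        rw [Real.rpow_add hn0]; ring

/-- **`ω(a,b,p) ≤ ω(a,b,q) + (p − q)` for `q ≤ p`** (third slot). -/
theorem omegaRect_le_add₃ {a b p q : ℝ} (hqp : q ≤ p) :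
    omegaRect K a b p ≤ omegaRect K a b q + (p - q) := by
  unfold omegaRect
  rw [← sub_le_iff_le_add]
  refine le_csInf (rectAdmissibleExponents_nonempty K a b q) fun β hβ => ?_
  rw [sub_le_iff_le_add]
  exact csInf_le (rectAdmissibleExponents_bddBelow K a b p) (add_mem_rectAdmissibleExponents₃ K hqp hβ)

/-- **`ω(a,p,c) ≤ ω(a,q,c) + (p − q)` for `q ≤ p`** (second slot). -/
theorem omegaRect_le_add₂ {a p q c : ℝ} (hqp : q ≤ p) :
    omegaRect K a p c ≤ omegaRect K a q c + (p - q) := by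
  rw [omegaRect_swap₂₃ K a p c, omegaRect_swap₂₃ K a q c]
  exact omegaRect_le_add₃ K hqp

/-- **`ω(p,b,c) ≤ ω(q,b,c) + (p − q)` for `q ≤ p`** (first slot). -/
theorem omegaRect_le_add₁ {p q b c : ℝ} (hqp : q ≤ p) :
    omegaRect K p b c ≤ omegaRect K q b c + (p - q) := by
  rw [omegaRect_swap₁₃ K p b c, omegaRect_swap₁₃ K q b c]
  exact omegaRect_le_add₃ K hqp

/-- **Three-slot Lipschitz bound**: for `a ≤ a'`, `b ≤ b'`, `c ≤ c'`,
`ω(a',b',c') ≤ ω(a,b,c) + (a'−a) + (b'−b) + (c'−c)`. -/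
theorem omegaRect_le_add {a a' b b' c c' : ℝ} (ha : a ≤ a') (hb : b ≤ b') (hc : c ≤ c') :
    omegaRect K a' b' c' ≤ omegaRect K a b c + ((a' - a) + (b' - b) + (c' - c)) := by
  have h₁ := omegaRect_le_add₁ K (b := b') (c := c') ha
  have h₂ := omegaRect_le_add₂ K (a := a) (c := c') hb
  have h₃ := omegaRect_le_add₃ K (a := a) (b := b) hc
  linarith

/-- **`ω` is 1-Lipschitz for the `ℓ¹` distance on exponent triples**:
`|ω(a,b,c) − ω(a',b',c')| ≤ |a − a'| + |b − b'| + |c − c'|` (the three-slot form of the continuity of the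
rectangular exponents, Lotti–Romani 1983; CLLZ 2025 Rem. 3.13). -/
theorem abs_omegaRect_sub_omegaRect_le (a b c a' b' c' : ℝ) :
    |omegaRect K a b c - omegaRect K a' b' c'| ≤ |a - a'| + |b - b'| + |c - c'| := by
  have hM : omegaRect K a b c ≤ omegaRect K a' b' c' + (|a - a'| + |b - b'| + |c - c'|) := by
    have h1 := omegaRect_mono K (le_max_left a a') (le_max_left b b') (le_max_left c c')
    have h2 := omegaRect_le_add K (le_max_right a a') (le_max_right b b') (le_max_right c c')
    have e₁ : max a a' - a' ≤ |a - a'| := by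
      rcases le_total a a' with h | h
      · rw [max_eq_right h, sub_self]; exact abs_nonneg _
      · rw [max_eq_left h]; exact le_abs_self _
    have e₂ : max b b' - b' ≤ |b - b'| := by
      rcases le_total b b' with h | h
      · rw [max_eq_right h, sub_self]; exact abs_nonneg _
      · rw [max_eq_left h]; exact le_abs_self _
    have e₃ : max c c' - c' ≤ |c - c'| := by
      rcases le_total c c' with h | h
      · rw [max_eq_right h, sub_self]; exact abs_nonneg _
      · rw [max_eq_left h]; exact le_abs_self _
    linarith
  have hM' : omegaRect K a' b' c' ≤ omegaRect K a b c + (|a - a'| + |b - b'| + |c - c'|) := by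
    have h1 := omegaRect_mono K (le_max_right a a') (le_max_right b b') (le_max_right c c')
    have h2 := omegaRect_le_add K (le_max_left a a') (le_max_left b b') (le_max_left c c')
    have e₁ : max a a' - a ≤ |a - a'| := by
      rcases le_total a a' with h | h
      · rw [max_eq_right h, abs_sub_comm]; exact le_abs_self _
      · rw [max_eq_left h, sub_self]; exact abs_nonneg _
    have e₂ : max b b' - b ≤ |b - b'| := by
      rcases le_total b b' with h | h
      · rw [max_eq_right h, abs_sub_comm]; exact le_abs_self _
      · rw [max_eq_left h, sub_self]; exact abs_nonneg _
    have e₃ : max c c' - c ≤ |c - c'| := by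
      rcases le_total c c' with h | h
      · rw [max_eq_right h, abs_sub_comm]; exact le_abs_self _
      · rw [max_eq_left h, sub_self]; exact abs_nonneg _
    linarith
  rw [abs_sub_le_iff]
  constructor <;> linarith

/-- **`(a,b,c) ↦ ω(a,b,c)` is continuous on `ℝ × ℝ × ℝ`.** -/
theorem continuous_omegaRect : Continuous fun p : ℝ × ℝ × ℝ => omegaRect K p.1 p.2.1 p.2.2 := by
  have hL : LipschitzWith 3 fun p : ℝ × ℝ × ℝ => omegaRect K p.1 p.2.1 p.2.2 := by
    refine LipschitzWith.of_dist_le_mul fun p q => ?_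
    rw [Real.dist_eq]
    have h := abs_omegaRect_sub_omegaRect_le K p.1 p.2.1 p.2.2 q.1 q.2.1 q.2.2
    have hp₂ : dist p.2 q.2 ≤ dist p q := by rw [Prod.dist_eq (x := p)]; exact le_max_right _ _
    have d₁ : |p.1 - q.1| ≤ dist p q := by
      rw [← Real.dist_eq, Prod.dist_eq (x := p)]; exact le_max_left _ _
    have d₂ : |p.2.1 - q.2.1| ≤ dist p q := by
      rw [← Real.dist_eq]
      exact le_trans (by rw [Prod.dist_eq (x := p.2)]; exact le_max_left _ _) hp₂
    have d₃ : |p.2.2 - q.2.2| ≤ dist p q := by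
      rw [← Real.dist_eq]
      exact le_trans (by rw [Prod.dist_eq (x := p.2)]; exact le_max_right _ _) hp₂
    have e : ((3 : NNReal) : ℝ) = 3 := by norm_num
    rw [e]
    linarith
  exact hL.continuous

end Slots

/-! ## Scalar extension: rational exponents, then all real exponents -/

section ScalarExtension

variable {K L : Type} [Field K] [Field L]

/-- **Rational exponents with a common denominator**: `ω_K(n₁/d, n₂/d, n₃/d) = ω_L(n₁/d, n₂/d, n₃/d)`
along any `f : K →+* L` (homogeneity `d · ω(n₁/d,n₂/d,n₃/d) = ω(n₁,n₂,n₃)` on both sides, Lotti–Romani 1983 /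
Huang–Pan 1998 §2 = the tree's `omegaRect_smul`, and BCS Cor. (15.18) for natural exponents =
`omegaRect_eq_omegaRect_of_ringHom`). -/
theorem omegaRect_natCast_div_eq_of_ringHom (f : K →+* L) (n₁ n₂ n₃ : ℕ) {d : ℕ} (hd : 1 ≤ d) :
    omegaRect K ((n₁ : ℝ) / d) ((n₂ : ℝ) / d) ((n₃ : ℝ) / d) =
      omegaRect L ((n₁ : ℝ) / d) ((n₂ : ℝ) / d) ((n₃ : ℝ) / d) := by
  have hdpos : (0 : ℝ) < d := by exact_mod_cast (by omega : 0 < d)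
  have hK := omegaRect_smul K hd (a := (n₁ : ℝ) / d) (b := (n₂ : ℝ) / d) (c := (n₃ : ℝ) / d)
    (by positivity) (by positivity) (by positivity)
  have hL := omegaRect_smul L hd (a := (n₁ : ℝ) / d) (b := (n₂ : ℝ) / d) (c := (n₃ : ℝ) / d)
    (by positivity) (by positivity) (by positivity)
  have e₁ : (d : ℝ) * ((n₁ : ℝ) / d) = n₁ := by field_simp
  have e₂ : (d : ℝ) * ((n₂ : ℝ) / d) = n₂ := by field_simp
  have e₃ : (d : ℝ) * ((n₃ : ℝ) / d) = n₃ := by field_simp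
  rw [e₁, e₂, e₃] at hK hL
  rw [omegaRect_eq_omegaRect_of_ringHom f n₁ n₂ n₃] at hK
  exact mul_left_cancel₀ hdpos.ne' (hK.symm.trans hL)

/-- Rounding a non-negative real UP to the grid `(1/d)ℕ`: `x ≤ ⌈x d⌉/d`. -/
theorem le_natCeil_mul_div (x : ℝ) {d : ℕ} (hd : (0 : ℝ) < d) : x ≤ (⌈x * d⌉₊ : ℝ) / d := by
  rw [le_div_iff₀ hd]
  exact Nat.le_ceil _

/-- … and `⌈x d⌉/d ≤ x + 1/d` for `x ≥ 0`. -/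
theorem natCeil_mul_div_le {x : ℝ} (hx : 0 ≤ x) {d : ℕ} (hd : (0 : ℝ) < d) :
    (⌈x * d⌉₊ : ℝ) / d ≤ x + 1 / d := by
  rw [div_le_iff₀ hd, add_mul, one_div_mul_cancel hd.ne']
  exact (Nat.ceil_lt_add_one (mul_nonneg hx hd.le)).le

variable (K L) in
/-- **Squeeze**: if `ω_K ≤ ω_L` at every non-negative rational triple with a common denominator, then
`ω_K(a,b,c) ≤ ω_L(a,b,c)` for all real `a, b, c ≥ 0` — round `(a,b,c)` up to the grid `(1/d)ℕ³`, use
monotonicity over `K` and the three-slot Lipschitz bound over `L`, and let `d → ∞`. -/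
theorem omegaRect_le_of_forall_natCast_div {a b c : ℝ} (ha : 0 ≤ a) (hb : 0 ≤ b) (hc : 0 ≤ c)
    (h : ∀ (n₁ n₂ n₃ d : ℕ), 1 ≤ d →
      omegaRect K ((n₁ : ℝ) / d) ((n₂ : ℝ) / d) ((n₃ : ℝ) / d) ≤
        omegaRect L ((n₁ : ℝ) / d) ((n₂ : ℝ) / d) ((n₃ : ℝ) / d)) :
    omegaRect K a b c ≤ omegaRect L a b c := by
  refine le_of_forall_pos_le_add fun ε hε => ?_
  obtain ⟨d, hd⟩ := exists_nat_gt (3 / ε)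
  have hdpos : (0 : ℝ) < d := lt_trans (by positivity) hd
  have hd1 : 1 ≤ d := Nat.one_le_iff_ne_zero.2 (by rintro rfl; simp at hdpos)
  have h3 : 3 * (1 / (d : ℝ)) < ε := by
    rw [← div_eq_mul_one_div, div_lt_iff₀ hdpos]
    rw [div_lt_iff₀ hε] at hd
    linarith
  have ha₁ := le_natCeil_mul_div a hdpos
  have hb₁ := le_natCeil_mul_div b hdpos
  have hc₁ := le_natCeil_mul_div c hdpos
  have ha₂ := natCeil_mul_div_le ha hdpos
  have hb₂ := natCeil_mul_div_le hb hdpos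
  have hc₂ := natCeil_mul_div_le hc hdpos
  have step₁ := omegaRect_mono K ha₁ hb₁ hc₁
  have step₂ := h ⌈a * d⌉₊ ⌈b * d⌉₊ ⌈c * d⌉₊ d hd1
  have step₃ := omegaRect_le_add L ha₁ hb₁ hc₁
  linarith

/-- **`ω_K(a,b,c) = ω_L(a,b,c)` for real `a, b, c ≥ 0`** along any homomorphism of fields `f : K →+* L`. -/
theorem omegaRect_eq_of_ringHom_of_nonneg (f : K →+* L) {a b c : ℝ} (ha : 0 ≤ a) (hb : 0 ≤ b)
    (hc : 0 ≤ c) : omegaRect K a b c = omegaRect L a b c :=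
  le_antisymm
    (omegaRect_le_of_forall_natCast_div K L ha hb hc fun n₁ n₂ n₃ _ hd =>
      (omegaRect_natCast_div_eq_of_ringHom f n₁ n₂ n₃ hd).le)
    (omegaRect_le_of_forall_natCast_div L K ha hb hc fun n₁ n₂ n₃ _ hd =>
      (omegaRect_natCast_div_eq_of_ringHom f n₁ n₂ n₃ hd).symm.le)

/-- **The rectangular exponent is invariant under scalar extension, for ALL REAL exponents**:
`ω_K(a,b,c) = ω_L(a,b,c)` along any homomorphism of fields `f : K →+* L` and every `a, b, c ∈ ℝ`
(the general form of the tree's `omegaRect_eq_omegaRect_of_ringHom`, BCS 1997 Cor. (15.18) for natural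
exponents; no sign hypothesis since `ω(a,b,c) = ω(a⁺,b⁺,c⁺)`). -/
theorem omegaRect_eq_of_ringHom (f : K →+* L) (a b c : ℝ) : omegaRect K a b c = omegaRect L a b c := by
  rw [← omegaRect_max_zero K a b c, ← omegaRect_max_zero L a b c]
  exact omegaRect_eq_of_ringHom_of_nonneg f (le_max_right _ _) (le_max_right _ _) (le_max_right _ _)

/-- `ω_L(a,b,c) = ω_K(a,b,c)` for a field extension `L ⊇ K` given as an algebra. -/
theorem omegaRect_algebraMap [Algebra K L] (a b c : ℝ) : omegaRect L a b c = omegaRect K a b c :=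
  (omegaRect_eq_of_ringHom (algebraMap K L) a b c).symm

/-- The tree's `omegaRect_one_mid_one_eq_of_ringHom` (`ω_K(1,p,1) = ω_L(1,p,1)`, `p ≥ 0`) without the sign
hypothesis. -/
theorem omegaRect_one_mid_one_eq_of_ringHom' (f : K →+* L) (p : ℝ) :
    omegaRect K 1 p 1 = omegaRect L 1 p 1 :=
  omegaRect_eq_of_ringHom f 1 p 1

/-! ## `ω(a,b,c)` depends only on the characteristic -/

/-- **Characteristic `0`**: `ω_K(a,b,c) = ω_ℚ(a,b,c)` for every field `K` of characteristic zero. -/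
theorem omegaRect_eq_rat [CharZero K] (a b c : ℝ) : omegaRect K a b c = omegaRect ℚ a b c :=
  (omegaRect_eq_of_ringHom (algebraMap ℚ K) a b c).symm

/-- **Characteristic `0`, `ℂ`-form**: `ω_K(a,b,c) = ω_ℂ(a,b,c)` for every field `K` of characteristic zero
(the record literature states its rectangular bounds over `ℂ`). -/
theorem omegaRect_eq_complex [CharZero K] (a b c : ℝ) : omegaRect K a b c = omegaRect ℂ a b c := by
  rw [omegaRect_eq_rat (K := K), omegaRect_eq_rat (K := ℂ)]

/-- **Characteristic `p`**: `ω_K(a,b,c) = ω_{𝔽_p}(a,b,c)` for every field `K` of prime characteristic `p`. -/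
theorem omegaRect_eq_zmod (p : ℕ) [Fact p.Prime] [CharP K p] (a b c : ℝ) :
    omegaRect K a b c = omegaRect (ZMod p) a b c :=
  (omegaRect_eq_of_ringHom (ZMod.castHom (dvd_refl p) K) a b c).symm

/-- **Two fields of the same characteristic have the same rectangular exponents `ω(a,b,c)`, all real
`a, b, c`.** -/
theorem omegaRect_eq_of_charP (p : ℕ) [CharP K p] [CharP L p] (a b c : ℝ) :
    omegaRect K a b c = omegaRect L a b c := by
  rcases CharP.char_is_prime_or_zero K p with hp | rfl
  · haveI : Fact p.Prime := ⟨hp⟩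
    rw [omegaRect_eq_zmod (K := K) p, omegaRect_eq_zmod (K := L) p]
  · haveI := CharP.charP_to_charZero K
    haveI := CharP.charP_to_charZero L
    rw [omegaRect_eq_rat (K := K), omegaRect_eq_rat (K := L)]

/-- **Transfer of `ℂ`-stated upper bounds**: an upper bound `ω_ℂ(a,b,c) ≤ B` (the form in which the laser-method
tables are printed) holds over every field of characteristic `0`. -/
theorem omegaRect_le_of_complex [CharZero K] {a b c B : ℝ} (h : omegaRect ℂ a b c ≤ B) :
    omegaRect K a b c ≤ B := by
  rwa [omegaRect_eq_complex (K := K)]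

/-- **Transfer of `ℂ`-stated lower bounds**: `B ≤ ω_ℂ(a,b,c)` holds over every field of characteristic `0`;
dually, a rectangular algorithm over ANY field of characteristic `0` bounds `ω_ℂ(a,b,c)`. -/
theorem le_omegaRect_of_complex [CharZero K] {a b c B : ℝ} (h : B ≤ omegaRect ℂ a b c) :
    B ≤ omegaRect K a b c := by
  rwa [omegaRect_eq_complex (K := K)]

end ScalarExtension

end Summit.MatrixMultiplication.OmegaCensus

end
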